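import Literature.NumberTheory.Rogawski1990.LocalTransferAtOneOfShalikaRankUnramifiedAll   -- ★ p853759 (LH4-p01 (g12)): `s3id_of_shalikaAntidiag_of_isUnramifiedIn` (the 2-free S3-ID chain: ★ RANK′ + ★ p853755 level-two fold over ★ p853750 organ (I) + ★ (H2) frame + ★ (H1-T4))
import Literature.NumberTheory.Rogawski1990.LocalTransferIdentityCoreDyadicDescent     -- ★ p849813 (LH4-p03 (g4)): the DYADIC vocabulary of the leaf (`n6nsDyadic_of_dyadicAntidiag`), imported so that the organ text below elaborates in the leaf's dialect
import Literature.NumberTheory.Automorphic.LocalUnitaryGroupCongr                       -- ★ `antidiagOne_isHermitian`, `isUnit_antidiagOne_det` (`Φ₃` hermitian, `det Φ₃ ≠ 0`)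
import HarnessLib

/-!
# Crux `H413`, line LH4∕LHD «DYADIC PAY-DOWN» — THE ★ TWIN OF ORGAN (D-UNR): `dyUnramCore` — local `Δ‴_v`-transfer of orbital integrals at `1` for the
# quasi-split form `Φ₃`, at every DYADIC non-split place `v` of `L⁺` UNRAMIFIED in the CM field `L`, GIVEN the Shalika germ expansion — PROVED IN-HOUSE
# (Rogawski 1990 Prop. 4.9.1 (a); Langlands–Shelstad [LS₂]) through the 2-free S3-ID chain (hermitian Cayley shift `φ_θ`, no `IsUnit 2` anywhere)

Cell `hodgecm-mathlib` (D-0151), FLOOR 0, crux item H413 = `stmt-HodgeConjecture-24833`, route of record `HCCMUnconditional`; squad F0∕P3c, line LH4, leaf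
`Cruxes/H413/Lines/F0_P3c_DyadicPaydown.lean` ED. 3 (organ (D-UNR) `stub_DyUnramCore` :103, PRINT [LS₂]); seat «LH4» LH4-p01 (g12) under LEAD F0P3a-plan T15-55
«GO-LOW on the CM-glue road, fence φ_θ EVERYWHERE».  THEOREMS ONLY (no `def`, no instance, no notation, no named-fact hypothesis, no `sorry`); imports = ★ Literature +
HarnessLib (no `Cruxes/**`); `--supports stmt-HodgeConjecture-24833`.  This file is the by-import CONSUMABLE form of the organ: a later leaf edition reads
`dyUnramCore` BY NAME in place of `stub_DyUnramCore` (the leaf is a workfile and is imported by nobody; editions, the closer rider and the registry are the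
desk's ∕ LEAD's ∕ registrar's acts, not this file's).

WHAT IS PROVED.  The organ text of `stub_DyUnramCore` TOKEN FOR TOKEN: «for every CM field `L`, unitary Hecke character `μ` of `L` restricting to the quadratic
character `ω_{L/L⁺}`, every finite place `v` of `L⁺` NON-SPLIT (`w ∣ v` fixed by complex conjugation) and UNRAMIFIED in `L`, and DYADIC (`¬ IsUnit (2 : 𝒪_w)`), given
canonical orbital-measure families on `H(L⁺_v) = U(Φ₂) × U(Φ₁)` and `G(L⁺_v) = U(Φ₃)` and the Shalika germ expansion for `U(Φ₃)(L⁺_v)`, every locally constant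
compactly supported `φ₃` on `U(Φ₃)(L⁺_v)` has a transfer `φH` near `1`: `SO_{γH}(φH) = Σ_c Δ‴_v(γH, c) · O_c(φ₃)` for all `G`-regular `γH` in a neighbourhood of `1`»
[Rogawski1990 §4.9 Prop. 4.9.1 (a) p. 55; LanglandsShelstad1989 Thm. (end of §2) p. 484].  The DYADIC hypothesis `¬ IsUnit 2` and the unitarity binder are NOT
used: the in-house road is uniform in the residue characteristic at unramified non-split places.

PROOF = ONE LINE: ★ `Literature.NumberTheory.Rogawski1990.s3id_of_shalikaAntidiag_of_isUnramifiedIn` (p853759) at `H′ := Φ₃` with ★ `antidiagOne_isHermitian L 3` and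
★ `isUnit_antidiagOne_det L 3`.  Behind that head (all ★, all 2-free): the hermitian frame (H2) `HermitianFrame.exists_formCongr_conjLocal_eq_smul_antidiag_three`; the
«`μ_w` unramified» discharge (H1-T4) `exists_nhds_localTransferAtOne_of_forall_isUnramifiedAt`; the descent `s3id_descent_of_formCongr`; RANK′
`exists_levelPieces_det_classOrbitalIntegral_ne_zero'`; the dyadic level-two fold `localTransferAtOne_of_hyperspecialLevel_le_two_of_isUnramifiedIn` (p853755) over the
organ (I) `liftInterior_of_levelTwo_of_isUnramifiedIn` (p853750) — the level-two interior lift run through the hermitian Cayley shift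
`φ_θ(g) = (θ•g + (c−θ)•1)·((c−σθ)•g + σθ•1)⁻¹`, `θ + σθ = 1`, in Eisenstein-centre currency at type-(2) elements (no discriminant parity, hence no `IsUnit 2`).

HONEST LABEL.  Count-neutral for the registry: `stub_N6nsDyadic` (closer `F0_U3LettersRung1.lean`) also needs organ (D-RAM) `stub_DyRamCore` (wild RAMIFIED base, PRINT, XL+),
untouched here.  `HC_CM` is proved only modulo the printed citations still open (hLiu418 = `stmt-HodgeConjecture-24832`, h413 = `stmt-HodgeConjecture-24833`) until rung 0 closes.

## References
* [Rogawski1990] J. D. Rogawski, *Automorphic Representations of Unitary Groups in Three Variables*, Ann. of Math. Stud. 123 (1990): §4.9 Prop. 4.9.1 (a) p. 55; §14.4 p. 237.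
* [LanglandsShelstad1989] R. P. Langlands, D. Shelstad, *Orbital integrals on forms of SL(3), II*, Canad. J. Math. 41 (1989) 480–507: Theorem (end of §2, p. 484).
-/

set_option autoImplicit false
-- the mandated namespace repeats the single-problem summit's segment (`HodgeConjecture.HodgeConjecture`)
set_option linter.dupNamespace false

noncomputable section

namespace Summit.HodgeConjecture.HodgeConjecture.Cruxes.H413.F0P3cDyUnramCore

open MeasureTheory Measure NumberField IsDedekindDomain Topology Filter
open Literature.NumberTheory.Automorphic Literature.NumberTheory.Automorphic.UnitaryGroup Literature.NumberTheory.Automorphic.IntegralReduction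
open Literature.NumberTheory.Rogawski1990 Literature.NumberTheory.GaloisRepresentations
open scoped Matrix MatrixGroups Classical ValuativeRel

/-- **ORGAN (D-UNR) PAID — `dyUnramCore`**: the organ text of `stub_DyUnramCore` (leaf `F0_P3c_DyadicPaydown.lean` ED. 3 :103) token for token — local
`Δ‴_v`-transfer of orbital integrals at `1` for the quasi-split unitary group `U(Φ₃)` over `L⁺_v`, at a DYADIC non-split place `v` of `L⁺` UNRAMIFIED in the CM
field `L`, for a unitary Hecke character `μ` restricting to `ω_{L/L⁺}`, GIVEN canonical orbital-measure families and the Shalika germ expansion for `U(Φ₃)(L⁺_v)`: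
every `φ₃ ∈ C_c^∞` has a transfer `φH` with `SO_{γH}(φH) = Σ_c Δ‴_v(γH, c)·O_c(φ₃)` for `G`-regular `γH` near `1`.  Proof: ★ `s3id_of_shalikaAntidiag_of_isUnramifiedIn`
(p853759) at `H′ = Φ₃`; the binders `_hμu` and `_h2 : ¬ IsUnit 2` are not used (the 2-free road is uniform in the residue characteristic).
[cite: Rogawski1990, §4.9 Prop. 4.9.1 (a) p. 55] [cite: LanglandsShelstad1989, Theorem (end of §2) p. 484] -/
theorem dyUnramCore :
    ∀ (L : Type) [Field L] [NumberField L] [IsCMField L] (μ : HeckeCharacter L)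
      {v : HeightOneSpectrum (𝓞 ↥(maximalRealSubfield L))} (w : UnitaryGroup.PlacesOver L v)
      (_hw : IsCMField.complexConj L • w.1 = w.1) (_hv : Algebra.IsUnramifiedIn (𝓞 L) v.asIdeal)
      (_hμu : μ.IsUnitary)
      (_hμω : ∀ x : ideleGroup ↥(maximalRealSubfield L), μ (AdeleRing.ideleBaseChange ↥(maximalRealSubfield L) L x) = quadraticHeckeCharCM L x)
      (_h2 : ¬ IsUnit (2 : 𝒪[w.1.adicCompletion L]))
      [MeasurableSpace ((UnitaryGroup.cmDatum L 3 (Matrix.of fun i j : Fin 3 => if i.val + j.val + 1 = 3 then (1 : L) else 0)).Local v)] [BorelSpace ((UnitaryGroup.cmDatum L 3 (Matrix.of fun i j : Fin 3 => if i.val + j.val + 1 = 3 then (1 : L) else 0)).Local v)]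
      [∀ γ : ((UnitaryGroup.cmDatum L 3 (Matrix.of fun i j : Fin 3 => if i.val + j.val + 1 = 3 then (1 : L) else 0)).Local v), MeasurableSpace (((UnitaryGroup.cmDatum L 3 (Matrix.of fun i j : Fin 3 => if i.val + j.val + 1 = 3 then (1 : L) else 0)).Local v) ⧸ Subgroup.centralizer ({γ} : Set ((UnitaryGroup.cmDatum L 3 (Matrix.of fun i j : Fin 3 => if i.val + j.val + 1 = 3 then (1 : L) else 0)).Local v)))]
      [∀ γ : ((UnitaryGroup.cmDatum L 3 (Matrix.of fun i j : Fin 3 => if i.val + j.val + 1 = 3 then (1 : L) else 0)).Local v), BorelSpace (((UnitaryGroup.cmDatum L 3 (Matrix.of fun i j : Fin 3 => if i.val + j.val + 1 = 3 then (1 : L) else 0)).Local v) ⧸ Subgroup.centralizer ({γ} : Set ((UnitaryGroup.cmDatum L 3 (Matrix.of fun i j : Fin 3 => if i.val + j.val + 1 = 3 then (1 : L) else 0)).Local v)))]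
      [MeasurableSpace ((UnitaryGroup.cmDatum L 2 (Matrix.of fun i j : Fin 2 => if i.val + j.val + 1 = 2 then (1 : L) else 0)).Local v × (UnitaryGroup.cmDatum L 1 (Matrix.of fun i j : Fin 1 => if i.val + j.val + 1 = 1 then (1 : L) else 0)).Local v)] [BorelSpace ((UnitaryGroup.cmDatum L 2 (Matrix.of fun i j : Fin 2 => if i.val + j.val + 1 = 2 then (1 : L) else 0)).Local v × (UnitaryGroup.cmDatum L 1 (Matrix.of fun i j : Fin 1 => if i.val + j.val + 1 = 1 then (1 : L) else 0)).Local v)]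
      [∀ a : ((UnitaryGroup.cmDatum L 2 (Matrix.of fun i j : Fin 2 => if i.val + j.val + 1 = 2 then (1 : L) else 0)).Local v × (UnitaryGroup.cmDatum L 1 (Matrix.of fun i j : Fin 1 => if i.val + j.val + 1 = 1 then (1 : L) else 0)).Local v), MeasurableSpace (((UnitaryGroup.cmDatum L 2 (Matrix.of fun i j : Fin 2 => if i.val + j.val + 1 = 2 then (1 : L) else 0)).Local v × (UnitaryGroup.cmDatum L 1 (Matrix.of fun i j : Fin 1 => if i.val + j.val + 1 = 1 then (1 : L) else 0)).Local v) ⧸ Subgroup.centralizer ({a} : Set ((UnitaryGroup.cmDatum L 2 (Matrix.of fun i j : Fin 2 => if i.val + j.val + 1 = 2 then (1 : L) else 0)).Local v × (UnitaryGroup.cmDatum L 1 (Matrix.of fun i j : Fin 1 => if i.val + j.val + 1 = 1 then (1 : L) else 0)).Local v)))]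
      [∀ a : ((UnitaryGroup.cmDatum L 2 (Matrix.of fun i j : Fin 2 => if i.val + j.val + 1 = 2 then (1 : L) else 0)).Local v × (UnitaryGroup.cmDatum L 1 (Matrix.of fun i j : Fin 1 => if i.val + j.val + 1 = 1 then (1 : L) else 0)).Local v), BorelSpace (((UnitaryGroup.cmDatum L 2 (Matrix.of fun i j : Fin 2 => if i.val + j.val + 1 = 2 then (1 : L) else 0)).Local v × (UnitaryGroup.cmDatum L 1 (Matrix.of fun i j : Fin 1 => if i.val + j.val + 1 = 1 then (1 : L) else 0)).Local v) ⧸ Subgroup.centralizer ({a} : Set ((UnitaryGroup.cmDatum L 2 (Matrix.of fun i j : Fin 2 => if i.val + j.val + 1 = 2 then (1 : L) else 0)).Local v × (UnitaryGroup.cmDatum L 1 (Matrix.of fun i j : Fin 1 => if i.val + j.val + 1 = 1 then (1 : L) else 0)).Local v)))]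
      (νH : Measure ((UnitaryGroup.cmDatum L 2 (Matrix.of fun i j : Fin 2 => if i.val + j.val + 1 = 2 then (1 : L) else 0)).Local v × (UnitaryGroup.cmDatum L 1 (Matrix.of fun i j : Fin 1 => if i.val + j.val + 1 = 1 then (1 : L) else 0)).Local v)) [νH.IsHaarMeasure] [νH.IsMulRightInvariant]
      (νG₃ : Measure ((UnitaryGroup.cmDatum L 3 (Matrix.of fun i j : Fin 3 => if i.val + j.val + 1 = 3 then (1 : L) else 0)).Local v)) [νG₃.IsHaarMeasure] [νG₃.IsMulRightInvariant]
      {mH : OrbitalMeasureFamily ((UnitaryGroup.cmDatum L 2 (Matrix.of fun i j : Fin 2 => if i.val + j.val + 1 = 2 then (1 : L) else 0)).Local v × (UnitaryGroup.cmDatum L 1 (Matrix.of fun i j : Fin 1 => if i.val + j.val + 1 = 1 then (1 : L) else 0)).Local v)} {mG₃ : OrbitalMeasureFamily ((UnitaryGroup.cmDatum L 3 (Matrix.of fun i j : Fin 3 => if i.val + j.val + 1 = 3 then (1 : L) else 0)).Local v)},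
      mH.IsCanonical (IsLocalGRegular L v) νH → mG₃.IsCanonical (fun γ => IsRegularElt (γ.val : GL (Fin 3) (UnitaryGroup.LocalRing L v))) νG₃ →
      ShalikaGermExpansionNonsplit L (Matrix.of fun i j : Fin 3 => if i.val + j.val + 1 = 3 then (1 : L) else 0) v →
      ∀ (φ₃ : ((UnitaryGroup.cmDatum L 3 (Matrix.of fun i j : Fin 3 => if i.val + j.val + 1 = 3 then (1 : L) else 0)).Local v) → ℂ), IsLocSmooth φ₃ →
        ∃ V ∈ 𝓝 (1 : ((UnitaryGroup.cmDatum L 2 (Matrix.of fun i j : Fin 2 => if i.val + j.val + 1 = 2 then (1 : L) else 0)).Local v × (UnitaryGroup.cmDatum L 1 (Matrix.of fun i j : Fin 1 => if i.val + j.val + 1 = 1 then (1 : L) else 0)).Local v)), ∃ φH : ((UnitaryGroup.cmDatum L 2 (Matrix.of fun i j : Fin 2 => if i.val + j.val + 1 = 2 then (1 : L) else 0)).Local v × (UnitaryGroup.cmDatum L 1 (Matrix.of fun i j : Fin 1 => if i.val + j.val + 1 = 1 then (1 : L) else 0)).Local v) → ℂ, IsLocSmooth φH ∧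
          ∀ γH ∈ V, IsLocalGRegular L v γH →
            stableOrbitalIntegralRel (IsLocalStablyConjH L v) mH φH γH =
              ∑ᶠ c : ConjClasses ((UnitaryGroup.cmDatum L 3 (Matrix.of fun i j : Fin 3 => if i.val + j.val + 1 = 3 then (1 : L) else 0)).Local v), ((finExplicitCollection L (Matrix.of fun i j : Fin 3 => if i.val + j.val + 1 = 3 then (1 : L) else 0) μ (finExplicitDelta_conj_left_all L (Matrix.of fun i j : Fin 3 => if i.val + j.val + 1 = 3 then (1 : L) else 0) μ) (finExplicitDelta_conj_right_all L (Matrix.of fun i j : Fin 3 => if i.val + j.val + 1 = 3 then (1 : L) else 0) μ)) v).Δ γH (Quotient.out c) * classOrbitalIntegral mG₃ φ₃ c := by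
  intro L _ _ _ μ v w hw hv _hμu hμω _h2 _ _ _ _ _ _ _ _ νH _ _ νG₃ _ _ mH mG₃ hmH hmG₃ hSh φ₃ hφ₃
  exact s3id_of_shalikaAntidiag_of_isUnramifiedIn L (Matrix.of fun i j : Fin 3 => if i.val + j.val + 1 = 3 then (1 : L) else 0) μ
    (antidiagOne_isHermitian L 3) (isUnit_antidiagOne_det L 3).ne_zero w hw hv hμω νH νG₃ hmH hmG₃ hSh φ₃ hφ₃

end Summit.HodgeConjecture.HodgeConjecture.Cruxes.H413.F0P3cDyUnramCore

end
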